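import Literature.MathematicalPhysics.QuantumLattice.XYOrderGDProofs
import HarnessLib

/-!
# Kennedy–Lieb–Shastry, XY model: discharge of the ground-state infrared bound (A)

Trunk T-QLATTICE; sibling of `XYOrderProofs.lean` (where the named fact (A)
`kls_xy_infraredBound_ground` — Kennedy–Lieb–Shastry, PRL 61 (1988), eq. (4) — is vendored),
`XYOrderInfraredProofs.lean` ((GD) ⇒ (A): `kls_xy_infraredBound_ground_of_gaussianDomination`,
the direct ground-state route of Kennedy–Lieb–Shastry, J. Stat. Phys. 53 (1988), eqs. (12)–(14),
(19): second-order perturbation theory, the susceptibility bound `χ_p ≤ ¼E_p⁻¹`, the spectral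
Cauchy–Schwarz inequality and the double commutator) and `XYOrderGDProofs.lean` ((GD)
`kls_xy_gaussianDomination_ground_holds`: Gaussian domination for the ground-state energy,
J. Stat. Phys. 53 (1988), eqs. (18)–(25), by reflection positivity in the coefficient matrix of a
ground state and the descent on bad bonds). No statement is introduced or changed: this file only
records the **named discharge**

* `kls_xy_infraredBound_ground_holds : kls_xy_infraredBound_ground`,

i.e. for every `d ≥ 2`, spin `n/2 ≥ 1/2`, even side `L = 2k ≥ 4` and dual-torus momentum `q ≠ 0`,
`0 ≤ ĝ¹_q` and `(ĝ¹_q)² Σᵢ (1 - cos qᵢ) ≤ ¼ Σᵢ (e₁ - e₃ cos qᵢ)` — the squared form of the printed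
`0 ≤ g¹_p ≤ ½ [Σᵢ (e₁ - e₃ cos pᵢ) / Σᵢ (1 - cos pᵢ)]^{1/2}`, of which the source says "This bound
is true for every finite `Λ` … It can also be derived directly in the ground state, as done in the
XXX context in Ref. 4" (PRL 61, p. 2583; read in E. H. Lieb, *Statistical Mechanics (Selecta)*,
Springer 2004, paper IV.8, p. 328).

## References

* [KLS1988PRL] T. Kennedy, E. H. Lieb, B. S. Shastry, *The XY model has long-range order for all
  spins and all dimensions greater than one*, Phys. Rev. Lett. 61 (1988) 2582–2584, eq. (4).
* [KLS1988JSP] T. Kennedy, E. H. Lieb, B. S. Shastry, *Existence of Néel order in some spin-½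
  Heisenberg antiferromagnets*, J. Stat. Phys. 53 (1988) 1019–1030, eqs. (12)–(14), (18)–(25).
-/

noncomputable section

namespace Literature.MathematicalPhysics.QuantumLattice

/-- **(A) The infrared bound in the ground state** (discharge of `kls_xy_infraredBound_ground`,
Kennedy–Lieb–Shastry 1988, eq. (4)): for every `d ≥ 2`, spin `n/2 ≥ 1/2`, even side
`L = 2k ≥ 4` and dual-torus momentum `q ≠ 0`, `0 ≤ ĝ¹_q` and
`(ĝ¹_q)² Σᵢ (1 - cos qᵢ) ≤ ¼ Σᵢ (e₁ - e₃ cos qᵢ)` ("This bound is true for every finite `Λ`",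
PRL 61, p. 2583). Proof: ground-state Gaussian domination (GD)
(`kls_xy_gaussianDomination_ground_holds`, the direct ground-state argument of KLS, J. Stat.
Phys. 53 (1988), eqs. (18)–(25)) fed into (GD) ⇒ (A)
(`kls_xy_infraredBound_ground_of_gaussianDomination`: KLS J. Stat. Phys. 53 (1988),
eqs. (12)–(14), (19)). [cite: KLS1988PRL, eq. (4)] [cite: KLS1988JSP, eqs. (12)–(14), (18)–(25)] -/
theorem kls_xy_infraredBound_ground_holds : kls_xy_infraredBound_ground :=
  kls_xy_infraredBound_ground_of_gaussianDomination kls_xy_gaussianDomination_ground_holds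

end Literature.MathematicalPhysics.QuantumLattice
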